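import Summits.Ventures.PercRepro.ProfileThreeMinors
import Summits.Ventures.PercRepro.ProfileTwoAverage
import Summits.Ventures.PercRepro.ProfileThreeFourLine

/-!
# PercRepro — THE ROW `q = 3` OF (Π) FROM ONE EXPLICIT INEQUALITY: THE AVERAGED DELETION STEP WITH THE
CO-RANK-3 SUPPLY (p10, gen 7; `proofs/P10-AVFULL.md`)

The plain averaged deletion step (Σ_z over the deletions `M ∖ z`, supply = all rank-`u` sets) fails for the row
`q = 3` (the cell's `avgdc` census): a rank-3 set `B` whose complement is nearly independent loses, under the
deletion of a coloop `z` of `E ∖ B`, more demand than the average can pay.  The remedy is to count the supply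
with the DISJOINTNESS shadow of the whole family: `W⁻_u(M) := #{S : ρ(S) = u, ρ(E ∖ S) ≥ 3}` (`levelSetCo`).
Its deletion average carries an extra slack — the LOST PAIRS: for a rank-`u` set `S` with `ρ(E ∖ S) = 3`,
deleting a coloop `z` of `E ∖ S` drops `ρ(E ∖ S ∖ z)` to `2`, so `S` is not counted in `W⁻_u(M ∖ z)`:

  `Σ_{z ∈ E} W⁻_u(M ∖ z) + Σ_{S ∈ W⁻} (#S − u) + Σ_{S ∈ W⁻, ρ(E∖S) = 3} #coloops(E ∖ S) ≤ (#E − u) · W⁻_u(M)`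
  (`sum_card_levelSetCo_delete_le`).

**The conjecture of record** `AvgStep M u` (data: 0 failures on all 1,724 matroids on 8 elements and on the
simple matroids on 9 elements; tight on the free matroid and at the top level):

  `(#E − u) · D₃(M; u) ≤ Σ_{B : ρ(B) = 3} Σ_{z ∉ B} D₃-demand_{M ∖ z}(B) + C(u,3) · [Σ_{S ∈ W⁻} (#S − u) + Σ_{S ∈ W⁻, ρ(E∖S)=3} #coloops(E∖S)]`.

By the per-set expansion `Σ_{z ∉ B} demand_{M∖z}(B) = (#(E∖B) − κ) · d_B + κ · d'_B` (`κ` = the coloops of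
`E ∖ B`, `sum_demand_delete_eq`) this is the explicit inequality
`Σ_B [κ_B · (d_B − d'_B) − (u − #B) · d_B] ≤ C(u,3) · [Σ_S (#S − u) + Σ_{ρ(E∖S)=3} κ(E ∖ S)]` of the paper.

**THEOREM** (`profileIneq_three_of_avgStep`): `AvgStep N u` for every simple `N` on `≥ u + 4` elements implies
`(Π_{3,u})` on every finite matroid (`u ≥ 4`): the strong induction on `#E` proves the stronger
`ProfileIneqMinus M u : D₃(M; u) ≤ C(u,3) · W⁻_u(M)` on every simple matroid (base `#E ≤ u + 3`: `B ↦ E ∖ B`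
lands in `W⁻`), and the reduction to simple matroids is the tree's `profileIneq_three_of_simple`.
Nothing here asserts `AvgStep`.

* `levelSetCo`, `mem_levelSetCo`, `ProfileIneqMinus`, `profileIneq_three_of_minus`;
* `levelSetCo_delete_eq_filter`, `card_filter_rk_erase_add_coloops_le`, **`sum_card_levelSetCo_delete_le`**;
* `sum_demand_delete_eq` — the per-set expansion (the explicit form of the step);
* `AvgStep`, `sum_sum_demand_delete_comm`, **`profileIneqMinus_step`**, `profileIneqMinus_of_card_le`,
  **`profileIneqMinus_of_avgStep`**, **`profileIneq_three_of_avgStep`**.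
-/

open scoped Matroid

namespace PercRepro.Cogirth

open Finset ThmH Skew Shadow Profile

variable {α : Type} [DecidableEq α] {M : Matroid α} [M.Finite]

/-! ### The co-rank-3 level set -/

/-- The rank-`u` sets whose complement has rank at least `3` — the disjointness shadow of the rank-3 sets. -/
noncomputable def levelSetCo (M : Matroid α) [M.Finite] (u : ℕ) : Finset (Finset α) :=
  (levelSet M u).filter (fun S => 3 ≤ rk M (gr M \ S))

/-- Membership in `levelSetCo`. -/
theorem mem_levelSetCo {u : ℕ} {S : Finset α} :
    S ∈ levelSetCo M u ↔ (S ⊆ gr M ∧ M.eRk (S : Set α) = (u : ℕ∞)) ∧ 3 ≤ rk M (gr M \ S) := by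
  unfold levelSetCo
  rw [mem_filter, mem_levelSet]

/-- **The row `q = 3` with the co-rank-3 supply**: `D₃(M; u) ≤ C(u,3) · W⁻_u(M)`. -/
def ProfileIneqMinus (M : Matroid α) [M.Finite] (u : ℕ) : Prop :=
  ∑ B ∈ Rq M 3, demand M 3 u B ≤ u.choose 3 * (levelSetCo M u).card

/-- `W⁻_u ≤ W_u`, so the co-rank-3 row implies the row. -/
theorem profileIneq_three_of_minus {u : ℕ} (hu : 3 ≤ u) (h : ProfileIneqMinus M u) : ProfileIneq M 3 u := by
  have hpos : 0 < u.choose 3 := Nat.choose_pos hu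
  rw [profileIneq_iff_demand 3 u hu hpos]
  unfold ProfileIneqMinus at h
  exact h.trans (Nat.mul_le_mul_left _ (card_le_card (filter_subset _ _)))

/-! ### The deletion average of the co-rank-3 level set -/

/-- The co-rank-3 rank-`u` sets of `M ∖ z` are the co-rank-3 rank-`u` sets `S ∌ z` of `M` whose complement
keeps rank `≥ 3` after erasing `z`. -/
theorem levelSetCo_delete_eq_filter (z : α) (u : ℕ) :
    levelSetCo (M ＼ ({z} : Set α)) u =
      (levelSetCo M u).filter (fun S => z ∉ S ∧ 3 ≤ rk M ((gr M \ S).erase z)) := by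
  ext S
  rw [mem_filter, mem_levelSetCo, mem_levelSetCo, gr_delete']
  constructor
  · rintro ⟨⟨hS, hr⟩, h3⟩
    have hzS : z ∉ S := fun h => (mem_erase.1 (hS h)).1 rfl
    have hS' : S ⊆ gr M := (subset_erase.1 hS).1
    rw [delete_singleton_eRk_eq (by rw [← coe_gr, ← Finset.coe_erase]; exact_mod_cast hS)] at hr
    rw [erase_sdiff, rk_delete (erase_subset_erase z sdiff_subset)] at h3
    refine ⟨⟨⟨hS', hr⟩, ?_⟩, hzS, h3⟩
    exact h3.trans (rk_mono_sub (erase_subset z _))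
  · rintro ⟨⟨⟨hS, hr⟩, _⟩, hzS, h3⟩
    have hS' : S ⊆ (gr M).erase z := subset_erase.2 ⟨hS, hzS⟩
    refine ⟨⟨hS', ?_⟩, ?_⟩
    · rw [delete_singleton_eRk_eq (by rw [← coe_gr, ← Finset.coe_erase]; exact_mod_cast hS')]
      exact hr
    · rw [erase_sdiff, rk_delete (erase_subset_erase z sdiff_subset)]
      exact h3

/-- For a set `X` of rank `3`, the elements whose erasure keeps rank `≥ 3` and the coloops of `X` are disjoint
subsets of `X`; for a set of rank `≠ 3` the first family alone is a subset of `X`.  In both cases: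
`#{z ∈ X : 3 ≤ ρ(X ∖ z)} + [ρ(X) = 3] · #coloops(X) ≤ #X`. -/
theorem card_filter_rk_erase_add_coloops_le {X : Finset α} (hX : X ⊆ gr M) :
    (X.filter (fun z => 3 ≤ rk M (X.erase z))).card +
      (if rk M X = 3 then (coloops M X).card else 0) ≤ X.card := by
  split_ifs with h3
  · rw [← card_union_of_disjoint]
    · apply card_le_card
      apply union_subset (filter_subset _ _) (coloops_subset X)
    · rw [disjoint_left]
      intro z hz hzc
      rw [mem_filter] at hz
      have := rk_erase_of_mem_coloops hX hzc
      omega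
  · rw [add_zero]
    exact card_le_card (filter_subset _ _)

/-- **The deletion average of `W⁻_u`, with the lost pairs**:
`Σ_{z ∈ E} W⁻_u(M ∖ z) + Σ_{S ∈ W⁻} (#S − u) + Σ_{S ∈ W⁻, ρ(E∖S) = 3} #coloops(E ∖ S) ≤ (#E − u) · W⁻_u(M)`. -/
theorem sum_card_levelSetCo_delete_le (u : ℕ) :
    ∑ z ∈ gr M, (levelSetCo (M ＼ ({z} : Set α)) u).card +
      (∑ S ∈ levelSetCo M u, (S.card - u) +
        ∑ S ∈ (levelSetCo M u).filter (fun S => rk M (gr M \ S) = 3), (coloops M (gr M \ S)).card) ≤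
      ((gr M).card - u) * (levelSetCo M u).card := by
  -- the left sum, reindexed over the sets `S`
  have h1 : ∑ z ∈ gr M, (levelSetCo (M ＼ ({z} : Set α)) u).card =
      ∑ S ∈ levelSetCo M u, ((gr M \ S).filter (fun z => 3 ≤ rk M ((gr M \ S).erase z))).card := by
    simp only [levelSetCo_delete_eq_filter, card_eq_sum_ones]
    apply sum_comm'
    intro z S
    simp only [mem_filter, mem_sdiff]
    tauto
  have h2 : ∑ S ∈ (levelSetCo M u).filter (fun S => rk M (gr M \ S) = 3), (coloops M (gr M \ S)).card =
      ∑ S ∈ levelSetCo M u, (if rk M (gr M \ S) = 3 then (coloops M (gr M \ S)).card else 0) := by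
    rw [sum_filter]
  rw [h1, h2, mul_comm, ← smul_eq_mul, ← sum_const, ← sum_add_distrib, ← sum_add_distrib]
  apply sum_le_sum
  intro S hS
  rw [mem_levelSetCo] at hS
  obtain ⟨⟨hSg, hSr⟩, _⟩ := hS
  have hX : gr M \ S ⊆ gr M := sdiff_subset
  have hc := card_filter_rk_erase_add_coloops_le (M := M) hX
  have hcard : (gr M \ S).card = (gr M).card - S.card := card_sdiff_of_subset hSg
  have hSle : S.card ≤ (gr M).card := card_le_card hSg
  have huS : u ≤ S.card := by
    have h := M.eRk_le_encard (S : Set α)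
    rw [hSr, Set.encard_coe_eq_coe_finsetCard] at h
    exact_mod_cast h
  omega

/-! ### The per-set expansion of the deletion sum -/

/-- `Σ_{z ∈ X} d(ρ(X ∖ z)) = (#X − κ) · d(ρ X) + κ · d(ρ X − 1)` for `d(r) = [u ≤ r] · C(r, u − q)`,
`κ := #coloops X` (the `q`-general form of `sum_ite_erase`). -/
theorem sum_ite_erase' {X : Finset α} (hX : X ⊆ gr M) (q u : ℕ) :
    ∑ z ∈ X, (if u ≤ rk M (X.erase z) then (rk M (X.erase z)).choose (u - q) else 0) =
      (X.card - (coloops M X).card) * (if u ≤ rk M X then (rk M X).choose (u - q) else 0) +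
        (coloops M X).card * (if u ≤ rk M X - 1 then (rk M X - 1).choose (u - q) else 0) := by
  have hKX : coloops M X ⊆ X := coloops_subset X
  rw [← sum_sdiff hKX]
  congr 1
  · rw [sum_congr rfl (fun z hz => by
        rw [rk_erase_of_notMem_coloops hX (sdiff_subset hz) (mem_sdiff.1 hz).2]),
      sum_const, smul_eq_mul, card_sdiff_of_subset hKX]
  · rw [sum_congr rfl (fun z hz => by
        have h := rk_erase_of_mem_coloops hX hz
        rw [show rk M (X.erase z) = rk M X - 1 by omega]),
      sum_const, smul_eq_mul]

/-- **The per-set expansion**: for a set `B`, with `κ` the coloops of `E ∖ B`,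
`Σ_{z ∈ E ∖ B} demand_{M∖z}(B) = (#(E ∖ B) − κ) · demand_M(B) + κ · [u ≤ ρ(E∖B) − 1] · C(ρ(E∖B) − 1, u − q)`. -/
theorem sum_demand_delete_eq (q u : ℕ) (B : Finset α) :
    ∑ z ∈ gr M \ B, demand (M ＼ ({z} : Set α)) q u B =
      ((gr M \ B).card - (coloops M (gr M \ B)).card) * demand M q u B +
        (coloops M (gr M \ B)).card *
          (if u ≤ rk M (gr M \ B) - 1 then (rk M (gr M \ B) - 1).choose (u - q) else 0) := by
  rw [sum_congr rfl (fun z _ => demand_delete_eq_ite' q u B z), sum_ite_erase' sdiff_subset q u]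
  rfl

/-! ### The averaged step and the theorem -/

/-- **THE AVERAGED DELETION STEP WITH THE CO-RANK-3 SUPPLY** (`AvgStep M u`), the conjecture of record of
p10 g7 for the row `q = 3` (data only; not asserted here):
`(#E − u) · D₃(M; u) ≤ Σ_{B : ρ(B) = 3} Σ_{z ∉ B} demand_{M∖z}(B) + C(u,3) · [Σ_{S ∈ W⁻} (#S − u) + Σ_{S ∈ W⁻, ρ(E∖S) = 3} #coloops(E ∖ S)]`. -/
def AvgStep (M : Matroid α) [M.Finite] (u : ℕ) : Prop :=
  ((gr M).card - u) * ∑ B ∈ Rq M 3, demand M 3 u B ≤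
    ∑ B ∈ Rq M 3, ∑ z ∈ gr M \ B, demand (M ＼ ({z} : Set α)) 3 u B +
      u.choose 3 * (∑ S ∈ levelSetCo M u, (S.card - u) +
        ∑ S ∈ (levelSetCo M u).filter (fun S => rk M (gr M \ S) = 3), (coloops M (gr M \ S)).card)

/-- The double sum of the deletion demands, reindexed: `Σ_B Σ_{z ∉ B} = Σ_z D₃(M ∖ z; u)`. -/
theorem sum_sum_demand_delete_comm (u : ℕ) :
    ∑ B ∈ Rq M 3, ∑ z ∈ gr M \ B, demand (M ＼ ({z} : Set α)) 3 u B =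
      ∑ z ∈ gr M, ∑ B ∈ Rq (M ＼ ({z} : Set α)) 3, demand (M ＼ ({z} : Set α)) 3 u B := by
  calc ∑ B ∈ Rq M 3, ∑ z ∈ gr M \ B, demand (M ＼ ({z} : Set α)) 3 u B
      = ∑ z ∈ gr M, ∑ B ∈ (Rq M 3).filter (fun B => z ∉ B), demand (M ＼ ({z} : Set α)) 3 u B := by
        apply sum_comm'
        intro B z
        rw [mem_sdiff, mem_filter]
        tauto
    _ = ∑ z ∈ gr M, ∑ B ∈ Rq (M ＼ ({z} : Set α)) 3, demand (M ＼ ({z} : Set α)) 3 u B := by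
        apply sum_congr rfl
        intro z _
        rw [Rq_delete_eq_filter]

/-- **The step**: the averaged step on `M` and the co-rank-3 row on every `M ∖ z` give the co-rank-3 row on
`M` (`#E > u`). -/
theorem profileIneqMinus_step {u : ℕ} (hn : u < (gr M).card) (hA : AvgStep M u)
    (hdel : ∀ z ∈ gr M, ProfileIneqMinus (M ＼ ({z} : Set α)) u) : ProfileIneqMinus M u := by
  unfold ProfileIneqMinus at hdel ⊢
  unfold AvgStep at hA
  rw [sum_sum_demand_delete_comm] at hA
  have hIH : ∑ z ∈ gr M, ∑ B ∈ Rq (M ＼ ({z} : Set α)) 3, demand (M ＼ ({z} : Set α)) 3 u B ≤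
      ∑ z ∈ gr M, u.choose 3 * (levelSetCo (M ＼ ({z} : Set α)) u).card :=
    sum_le_sum (fun z hz => hdel z hz)
  rw [← mul_sum] at hIH
  have hsup := sum_card_levelSetCo_delete_le (M := M) u
  have hmain : ((gr M).card - u) * ∑ B ∈ Rq M 3, demand M 3 u B ≤
      ((gr M).card - u) * (u.choose 3 * (levelSetCo M u).card) := by
    calc ((gr M).card - u) * ∑ B ∈ Rq M 3, demand M 3 u B
        ≤ _ := hA
      _ ≤ u.choose 3 * (∑ z ∈ gr M, (levelSetCo (M ＼ ({z} : Set α)) u).card) +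
            u.choose 3 * (∑ S ∈ levelSetCo M u, (S.card - u) +
              ∑ S ∈ (levelSetCo M u).filter (fun S => rk M (gr M \ S) = 3),
                (coloops M (gr M \ S)).card) := by gcongr
      _ = u.choose 3 * (∑ z ∈ gr M, (levelSetCo (M ＼ ({z} : Set α)) u).card +
            (∑ S ∈ levelSetCo M u, (S.card - u) +
              ∑ S ∈ (levelSetCo M u).filter (fun S => rk M (gr M \ S) = 3),
                (coloops M (gr M \ S)).card)) := by ring
      _ ≤ u.choose 3 * (((gr M).card - u) * (levelSetCo M u).card) := Nat.mul_le_mul_left _ hsup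
      _ = ((gr M).card - u) * (u.choose 3 * (levelSetCo M u).card) := by ring
  exact Nat.le_of_mul_le_mul_left hmain (by omega)

omit [DecidableEq α] in
/-- `ρ(X) ≤ #X`. -/
theorem rk_le_card' (X : Finset α) : rk M X ≤ X.card := by
  unfold rk
  have := M.eRk_le_encard (X : Set α)
  rw [Set.encard_coe_eq_coe_finsetCard] at this
  exact ENat.toNat_le_of_le_coe this

/-- **The base**: on `≤ u + 3` elements the co-rank-3 row holds — every positive demand is exactly `C(u,3)`,
attained only when `E ∖ B` has rank `u`, and then `B ↦ E ∖ B` lands injectively in `W⁻` (`u ≥ 3`). -/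
theorem profileIneqMinus_of_card_le {u : ℕ} (hu : 3 ≤ u) (hn : (gr M).card ≤ u + 3) :
    ProfileIneqMinus M u := by
  unfold ProfileIneqMinus
  have hkey : ∀ B ∈ (Rq M 3).filter (fun B => demand M 3 u B ≠ 0),
      demand M 3 u B = u.choose 3 ∧ gr M \ B ∈ levelSetCo M u := by
    intro B hB
    rw [mem_filter, mem_Rq] at hB
    obtain ⟨⟨hBg, hBr⟩, hne⟩ := hB
    have hr3 : rk M B = 3 := by unfold rk; rw [hBr, ENat.toNat_coe]
    have hBc : rk M B ≤ B.card := rk_le_card' B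
    have hcomp : (gr M \ B).card = (gr M).card - B.card := card_sdiff_of_subset hBg
    have hrle : rk M (gr M \ B) ≤ (gr M \ B).card := rk_le_card' _
    have hle : u ≤ rk M (gr M \ B) := by
      by_contra hlt
      apply hne
      unfold demand
      rw [if_neg hlt]
    have hru : rk M (gr M \ B) = u := by omega
    constructor
    · unfold demand
      rw [if_pos hle, hru, Nat.choose_symm (by omega)]
    · rw [mem_levelSetCo, Finset.sdiff_sdiff_eq_self hBg, hr3]
      refine ⟨⟨sdiff_subset, ?_⟩, le_refl _⟩
      rw [← coe_rk, hru]
  calc ∑ B ∈ Rq M 3, demand M 3 u B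
      = ∑ B ∈ (Rq M 3).filter (fun B => demand M 3 u B ≠ 0), demand M 3 u B :=
        (sum_filter_ne_zero _).symm
    _ = ∑ B ∈ (Rq M 3).filter (fun B => demand M 3 u B ≠ 0), u.choose 3 :=
        sum_congr rfl (fun B hB => (hkey B hB).1)
    _ = u.choose 3 * ((Rq M 3).filter (fun B => demand M 3 u B ≠ 0)).card := by
        rw [sum_const, smul_eq_mul, mul_comm]
    _ ≤ u.choose 3 * (levelSetCo M u).card := by
        apply Nat.mul_le_mul_left
        apply card_le_card_of_injOn (fun B => gr M \ B)
        · intro B hB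
          exact (hkey B hB).2
        · intro B hB B' hB' heq
          have hBg : B ⊆ gr M := (mem_Rq.1 (mem_filter.1 hB).1).1
          have hB'g : B' ⊆ gr M := (mem_Rq.1 (mem_filter.1 hB').1).1
          simp only at heq
          rw [← Finset.sdiff_sdiff_eq_self hBg, ← Finset.sdiff_sdiff_eq_self hB'g, heq]

/-- **THE CO-RANK-3 ROW ON EVERY SIMPLE MATROID FROM THE AVERAGED STEP** (`u ≥ 3`): strong induction on `#E`
over the simple matroids; the base `#E ≤ u + 3`, the step `profileIneqMinus_step` with `AvgStep` on `M` and
the induction hypothesis on the simple matroids `M ∖ z`. -/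
theorem profileIneqMinus_of_avgStep {u : ℕ} (hu : 3 ≤ u)
    (hA : ∀ (N : Matroid α) [N.Finite], Simple' N → u + 4 ≤ (gr N).card → AvgStep N u)
    (M : Matroid α) [M.Finite] (hs : Simple' M) : ProfileIneqMinus M u := by
  suffices hh : ∀ n : ℕ, ∀ (N : Matroid α) [N.Finite], (gr N).card = n → Simple' N → ProfileIneqMinus N u from
    hh _ M rfl hs
  intro n
  induction n using Nat.strong_induction_on with
  | _ n ih =>
  intro N _ hN hsN
  rcases Nat.lt_or_ge (gr N).card (u + 4) with hsmall | hbig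
  · exact profileIneqMinus_of_card_le hu (by omega)
  · apply profileIneqMinus_step (by omega) (hA N hsN hbig)
    intro z hz
    have hlt : ((gr N).erase z).card < n := by rw [← hN]; exact card_erase_lt_of_mem hz
    exact ih _ hlt (N ＼ ({z} : Set α)) (by rw [gr_delete']) (simple'_delete hsN z)

/-- **THE ROW `q = 3` OF (Π) ON EVERY FINITE MATROID FROM THE AVERAGED STEP** (`u ≥ 4`): `AvgStep N u` on every
simple `N` with `#E ≥ u + 4` gives `(Π_{3,u})(M)` for every finite matroid `M`. -/
theorem profileIneq_three_of_avgStep {u : ℕ} (hu : 4 ≤ u)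
    (hA : ∀ (N : Matroid α) [N.Finite], Simple' N → u + 4 ≤ (gr N).card → AvgStep N u)
    (M : Matroid α) [M.Finite] : ProfileIneq M 3 u :=
  profileIneq_three_of_simple hu
    (fun N _ hs => profileIneq_three_of_minus (by omega) (profileIneqMinus_of_avgStep (by omega) hA N hs)) M

end PercRepro.Cogirth
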